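import Summits.NavierStokesRegularity.NavierStokesRegularity.Theorems.HubbleDynamoNoSelfExcitedDynamoStubPastShift
import Summits.NavierStokesRegularity.NavierStokesRegularity.Theorems.HubbleDynamoNoSelfExcitedDynamoStubForwardVanishing
import Summits.NavierStokesRegularity.NavierStokesRegularity.Theorems.HubbleDynamoNoSelfExcitedDynamoReduction
import HarnessLib

/-!
# Crux `NoSelfExcitedDynamo` (stmt-NavierStokesRegularity-1934), line `registered`: sub-Leray
  amplitude in the REMOTE PAST kills an eternal profile-class field; the switch-off hypothesis of
  the eternal Liouville problem is redundant

Theorems file (lands `--supports stmt-NavierStokesRegularity-1934`; registered sub-goals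
`remotePastLiouville`, `eternalLiouville_of_switchOff`, `noSelfExcitedDynamo_of_remotePastSqueeze`).
It makes durable the closed glue of the lead's skeleton v4 (`Cruxes/NoSelfExcitedDynamo/Lines/birth.lean`):

* `remotePastLiouville` — an ETERNAL classical solution `(U, P)` of Leray's backward system
  `∂ₛU + ½U + ½(y·∇)U + (U·∇)U + ∇P = ΔU`, `div U = 0` on `ℝ × ℝ³` in the uniform profile class
  `(1 + ‖y‖)^{k+1}‖DᵏU(s, y)‖ ≤ K_k` whose amplitude is below Leray's constant ONLY IN THE REMOTE
  PAST, `‖U(s, y)‖ ≤ A < 1` for all `s ≤ S`, vanishes identically. No switch-off is assumed. Proof: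
  the physical time shift `t ↦ t − e^{−S}` read in similarity variables (`stub_pastShift`, p-landed)
  produces an eternal profile-class solution `V` which samples `U` only at similarity times
  `s′ ≤ S`, so `sup ‖V‖ ≤ A < 1` and the Backus regime (`stub_backusRegime`, p150871) gives `V ≡ 0`,
  whence `U ≡ 0` on `s < S`; forward vanishing inside the profile class (`stub_forwardVanishing`,
  p154885) finishes. In physical variables: a Type-I ancient field (`‖Dᵏu‖ ≤ K_k/(‖x‖ + √(−t))^{k+1}`)
  with `limsup_{t → −∞} √(−t)‖u(t)‖_∞ < 1` vanishes — "a Type-I ancient field is born with amplitude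
  at least Leray's constant, or not at all".
* `eternalLiouville_of_switchOff` — IF every eternal profile-class solution which switches off like
  `‖U(s, y)‖ ≤ M e^{−s/2}` vanishes, THEN every eternal profile-class solution vanishes (the shifted
  profile of `stub_pastShift` switches off like `K₀ τ^{−1/2} e^{−s/2}` and returns `U ≡ 0` on
  `s < −log τ`, for every `τ > 0`). With `stub_eternalReduction` (p151325) and
  `stub_eternalLiouvilleOfCrux` (p152276) this records the equivalence
  crux ⇔ "Leray's backward system has NO nontrivial eternal solution in the uniform profile class"
  (no switch-off clause) — the route's thesis object "no self-excited dynamo in Hubble flow".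
* `noSelfExcitedDynamo_of_remotePastSqueeze` — the crux (conclusion unfolded) follows from the
  line's one open stub `stub_remotePastSqueeze` (remote-past squeeze for switching-off eternal
  profile-class solutions), by `stub_eternalReduction` and `remotePastLiouville`.
-/

noncomputable section

-- the mandated stub namespace repeats `NavierStokesRegularity` (tree precedent for this crux's stubs)
set_option linter.dupNamespace false

namespace Summit.NavierStokesRegularity.NavierStokesRegularity.Theorems.NoSelfExcitedDynamo.Registered

open Set MeasureTheory Filter Topology
open scoped ContDiff
open Literature.Analysis.FluidPDE

/-- **Sub-Leray amplitude in the remote past kills the eternal field** (registered sub-goal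
`remotePastLiouville`). An eternal classical solution of Leray's backward system (`a = ½`, `ν = 1`)
on `ℝ × ℝ³` in the uniform profile class with `‖U(s, y)‖ ≤ A < 1` for all `s ≤ S` and all `y`
vanishes identically: shift the physical time by `τ = e^{−S}` (`stub_pastShift`) — the deformed
profile `V` only samples `U` at similarity times `s′ ≤ −log τ = S`, so `sup ‖V‖ ≤ A < 1` and the
Backus regime `stub_backusRegime` gives `V ≡ 0`, i.e. `U ≡ 0` on `s < S`; then forward vanishing
`stub_forwardVanishing`. -/
theorem remotePastLiouville :
    ∀ (U : ℝ → EuclideanSpace ℝ (Fin 3) → EuclideanSpace ℝ (Fin 3)) (P : ℝ → EuclideanSpace ℝ (Fin 3) → ℝ),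
      IsBackwardLeraySolutionOn univ 1 U P →
      (∀ k : ℕ, ∃ K : ℝ, ∀ s y, (1 + ‖y‖) ^ (k + 1) * ‖iteratedFDeriv ℝ k (U s) y‖ ≤ K) →
      (∃ A : ℝ, A < 1 ∧ ∃ S : ℝ, ∀ s ≤ S, ∀ y, ‖U s y‖ ≤ A) → ∀ s y, U s y = 0 := by
  intro U P hL hprof hA
  obtain ⟨A, hA1, S, hAS⟩ := hA
  have hτ : 0 < Real.exp (-S) := Real.exp_pos _
  have hlog : -Real.log (Real.exp (-S)) = S := by rw [Real.log_exp, neg_neg]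
  obtain ⟨V, Q, hV, hVprof, hVamp, -, hVback⟩ := stub_pastShift U P hL hprof (Real.exp (-S)) hτ
  rw [hlog] at hVamp hVback
  have hV0 : ∀ s y, V s y = 0 := stub_backusRegime V Q hV hVprof ⟨A, hA1, hVamp A hAS⟩
  exact stub_forwardVanishing U P hL hprof (S - 1) fun s hs y => hVback hV0 s (by linarith) y

/-- **The switch-off hypothesis of the eternal Liouville problem is redundant** (registered
sub-goal `eternalLiouville_of_switchOff`): if every eternal profile-class solution of Leray's
backward system which switches off like `‖U(s, y)‖ ≤ M e^{−s/2}` vanishes, then EVERY eternal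
profile-class solution vanishes. For `τ > 0` the time-shifted profile of `stub_pastShift` is eternal,
in the profile class, switches off like `K₀ τ^{−1/2} e^{−s/2}` (`‖U‖ ≤ K₀` from the `k = 0` profile
bound), hence vanishes, which returns `U ≡ 0` on `s < −log τ`; now let `τ ↓ 0`. -/
theorem eternalLiouville_of_switchOff :
    (∀ (U : ℝ → EuclideanSpace ℝ (Fin 3) → EuclideanSpace ℝ (Fin 3)) (P : ℝ → EuclideanSpace ℝ (Fin 3) → ℝ),
      IsBackwardLeraySolutionOn univ 1 U P →
      (∀ k : ℕ, ∃ K : ℝ, ∀ s y, (1 + ‖y‖) ^ (k + 1) * ‖iteratedFDeriv ℝ k (U s) y‖ ≤ K) →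
      (∃ M : ℝ, ∀ s y, ‖U s y‖ ≤ M * Real.exp (-s / 2)) → ∀ s y, U s y = 0) →
    ∀ (U : ℝ → EuclideanSpace ℝ (Fin 3) → EuclideanSpace ℝ (Fin 3)) (P : ℝ → EuclideanSpace ℝ (Fin 3) → ℝ),
      IsBackwardLeraySolutionOn univ 1 U P →
      (∀ k : ℕ, ∃ K : ℝ, ∀ s y, (1 + ‖y‖) ^ (k + 1) * ‖iteratedFDeriv ℝ k (U s) y‖ ≤ K) →
      ∀ s y, U s y = 0 := by
  intro h U P hL hprof s y
  obtain ⟨K₀, hK₀'⟩ := hprof 0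
  have hK₀ : ∀ s y, ‖U s y‖ ≤ K₀ := fun s y => by
    have h1 := hK₀' s y
    rw [zero_add, pow_one, norm_iteratedFDeriv_zero] at h1
    exact (le_mul_of_one_le_left (norm_nonneg _) (le_add_of_nonneg_right (norm_nonneg _))).trans h1
  have hτ : 0 < Real.exp (-(s + 1)) := Real.exp_pos _
  have hlog : -Real.log (Real.exp (-(s + 1))) = s + 1 := by rw [Real.log_exp, neg_neg]
  obtain ⟨V, Q, hV, hVprof, -, hVoff, hVback⟩ := stub_pastShift U P hL hprof (Real.exp (-(s + 1))) hτ
  rw [hlog] at hVback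
  have hV0 : ∀ s y, V s y = 0 :=
    h V Q hV hVprof ⟨K₀ * (Real.sqrt (Real.exp (-(s + 1))))⁻¹, hVoff K₀ hK₀⟩
  exact hVback hV0 s (by linarith) y

/-- **The crux from the remote-past squeeze** (registered sub-goal
`noSelfExcitedDynamo_of_remotePastSqueeze`; the composition of the line's skeleton v4, made
durable): IF every eternal profile-class solution of Leray's backward system which switches off in
the future had amplitude below Leray's constant in the remote past (`∃ A < 1, ∃ S, ‖U(s, y)‖ ≤ A`
for `s ≤ S` — the line's one open stub `stub_remotePastSqueeze`), THEN `NoSelfExcitedDynamo` holds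
(conclusion written unfolded): `stub_eternalReduction` (p151325) and `remotePastLiouville`. -/
theorem noSelfExcitedDynamo_of_remotePastSqueeze :
    (∀ (U : ℝ → EuclideanSpace ℝ (Fin 3) → EuclideanSpace ℝ (Fin 3)) (P : ℝ → EuclideanSpace ℝ (Fin 3) → ℝ),
      IsBackwardLeraySolutionOn univ 1 U P →
      (∀ k : ℕ, ∃ K : ℝ, ∀ s y, (1 + ‖y‖) ^ (k + 1) * ‖iteratedFDeriv ℝ k (U s) y‖ ≤ K) →
      (∃ M : ℝ, ∀ s y, ‖U s y‖ ≤ M * Real.exp (-s / 2)) →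
      ∃ A : ℝ, A < 1 ∧ ∃ S : ℝ, ∀ s ≤ S, ∀ y, ‖U s y‖ ≤ A) →
    ∀ u : ℝ → EuclideanSpace ℝ (Fin 3) → EuclideanSpace ℝ (Fin 3),
      IsBoundedAncientMildSolution 1 u →
      (∀ t < 0, AEStronglyMeasurable (u t) volume) → (∃ C : ℝ, HasTypeIDecay C u) →
      ∀ t < 0, u t =ᵐ[volume] (0 : EuclideanSpace ℝ (Fin 3) → EuclideanSpace ℝ (Fin 3)) :=
  fun hC => stub_eternalReduction fun U P hL hprof hM => remotePastLiouville U P hL hprof (hC U P hL hprof hM)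

end Summit.NavierStokesRegularity.NavierStokesRegularity.Theorems.NoSelfExcitedDynamo.Registered

end
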